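import Mathlib
import Summits.NavierStokesRegularity.NavierStokesRegularity.Theorems.FilamentSkeletonRssStadiumPlateauKernel

/-!
# The plateau integral is `O(log)` (`TangentSkeletonNearStraightL`, stmt-NavierStokesRegularity-23320, registered stub `stub_stripPropagation` —
# the `√Γ log Γ` source, blueprint item R6 of `DIAG-addendum-contour-g2.md`)

Abstract plateau bound: if along the plateau `[a,b] + iy₀` the kernel seen from the plateau target `z = τ + iy₀` (`τ ∈ [a,b]`) is dominated by the even
near-diagonal majorant `s ↦ (c s² + μ²)^{−3/2}·(2B₁K₂ s²)` in the offset `s = σ − τ` (this is Theorems.StadiumPlateauKernel.plateau_kernel_norm_le with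
`μ² = κ/(2Λ)`), then `‖∫_a^b kernel dσ‖ ≤ 4B₁K₂(1/3 + log((b−a)√c/μ))/c^{3/2}` as soon as `μ/√c ≤ b − a` (`plateau_integral_norm_le`): shift
`σ = τ + s`, enlarge `[a−τ, b−τ] ⊆ [−(b−a), b−a]` (nonnegative majorant), and Theorems.StadiumNearKernelBound.near_kernel_integral_le.  In the retype
`b − a = 2(L + 8h)`, `c ≈ 0.76`, `K₂ = 2/(7h)`, `h = cs√Γ/16`: `O(log Γ/√Γ)` per unit circulation, i.e. `O(√Γ log Γ)` after the prefactor `Γγ/4π`.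
HONEST FRAMING: a tool for a HYPOTHETICAL filament skeleton on the NEGATIVE side of a MODEL route; nothing here bears on Navier–Stokes regularity or
blow-up.  `--supports stmt-NavierStokesRegularity-23320`.
-/

set_option linter.dupNamespace false

noncomputable section

namespace Summit.NavierStokesRegularity.NavierStokesRegularity.Theorems.StadiumPlateauLog

open Set MeasureTheory intervalIntegral
open Summit.NavierStokesRegularity.NavierStokesRegularity.Theorems.StadiumNearKernelBound

/-- **Abstract plateau bound.**  `E`-valued integrand on `[a,b]` dominated by the shifted even majorant ⇒ `O(log)` bound. [folklore] -/
theorem plateau_integral_norm_le {E : Type*} [NormedAddCommGroup E] [NormedSpace ℝ E] {f : ℝ → E} {a b τ c μ B₁ K₂ : ℝ}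
    (hab : a ≤ b) (hτ : τ ∈ Icc a b) (hc : 0 < c) (hμ : 0 < μ) (hR : μ / Real.sqrt c ≤ b - a) (hBK : 0 ≤ B₁ * K₂)
    (hdom : ∀ σ ∈ Icc a b, ‖f σ‖ ≤ (c * (σ - τ) ^ 2 + μ ^ 2) ^ (-(3/2 : ℝ)) * (2 * B₁ * K₂ * (σ - τ) ^ 2)) :
    ‖∫ σ in a..b, f σ‖ ≤ 4 * (B₁ * K₂) * ((1/3 + Real.log ((b - a) * Real.sqrt c / μ)) / c ^ (3/2 : ℝ)) := by
  set g : ℝ → ℝ := fun s => 2 * B₁ * K₂ * (s ^ 2 / (c * s ^ 2 + μ ^ 2) ^ (3/2 : ℝ)) with hg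
  have hden_pos : ∀ s : ℝ, 0 < (c * s ^ 2 + μ ^ 2) ^ (3/2 : ℝ) := fun s => Real.rpow_pos_of_pos (by positivity) _
  have hg_cont : Continuous g := by
    have h1 : Continuous fun s : ℝ => (c * s ^ 2 + μ ^ 2) ^ (3/2 : ℝ) :=
      Continuous.rpow_const (by fun_prop) fun s => Or.inr (by norm_num)
    exact continuous_const.mul ((continuous_pow 2).div h1 fun s => (hden_pos s).ne')
  have hg_nonneg : ∀ s, 0 ≤ g s := fun s => by
    simp only [hg]
    exact mul_nonneg (by linarith) (div_nonneg (sq_nonneg _) (hden_pos s).le)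
  have hmaj_eq : ∀ s : ℝ, (c * s ^ 2 + μ ^ 2) ^ (-(3/2 : ℝ)) * (2 * B₁ * K₂ * s ^ 2) = g s := by
    intro s
    simp only [hg]
    exact majorant_eq (by positivity)
  -- norm of the integral ≤ integral of the shifted majorant
  have h1 : ‖∫ σ in a..b, f σ‖ ≤ ∫ σ in a..b, g (σ - τ) := by
    refine intervalIntegral.norm_integral_le_of_norm_le hab ?_ ((hg_cont.comp (continuous_id.sub continuous_const)).intervalIntegrable _ _)
    refine Filter.Eventually.of_forall fun σ hσ => ?_
    have h := hdom σ (Ioc_subset_Icc_self hσ)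
    rw [hmaj_eq] at h
    exact h
  -- shift and enlarge the interval
  have h2 : ∫ σ in a..b, g (σ - τ) = ∫ s in (a - τ)..(b - τ), g s := by
    rw [intervalIntegral.integral_comp_sub_right (fun s => g s) τ]
  have h3 : ∫ s in (a - τ)..(b - τ), g s ≤ ∫ s in (-(b - a))..(b - a), g s := by
    refine intervalIntegral.integral_mono_interval ?_ ?_ (by linarith [hτ.1, hτ.2]) ?_ ?_
    · linarith [hτ.2]
    · linarith [hτ.1, hτ.2]
    · exact Filter.Eventually.of_forall hg_nonneg
    · exact hg_cont.intervalIntegrable _ _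
  have h4 := near_kernel_integral_le (R := b - a) hc hμ hR hBK
  calc ‖∫ σ in a..b, f σ‖ ≤ ∫ σ in a..b, g (σ - τ) := h1
    _ = ∫ s in (a - τ)..(b - τ), g s := h2
    _ ≤ ∫ s in (-(b - a))..(b - a), g s := h3
    _ ≤ 4 * (B₁ * K₂) * ((1/3 + Real.log ((b - a) * Real.sqrt c / μ)) / c ^ (3/2 : ℝ)) := h4

end Summit.NavierStokesRegularity.NavierStokesRegularity.Theorems.StadiumPlateauLog

end
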